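import Literature.Analysis.FluidPDE.TaoUnitViscosity
import Literature.Analysis.FluidPDE.NSUnconditionalUniquenessHolds
import Literature.Analysis.FluidPDE.TaoEnstrophyExteriorHolds
import HarnessLib

/-!
# Tao (2011/2013), Cor. 11.1, Thm. 10.1 (exterior and a priori forms) and Cor. 11.4 (velocity
# form) at unit viscosity, as printed, are theorems

Discharge file for the unit-viscosity (`ν = 1`, as printed: arXiv:1108.1165, footnote 3, p. 4)
named facts of `TaoUnitViscosity.lean` that were still open:

* `tao2011_boundedEnstrophy_unit` — T. Tao, *Localisation and compactness properties of the
  Navier–Stokes global regularity problem*, Anal. PDE 6 (2013) 25–107 = arXiv:1108.1165,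
  Cor. 11.1 (Bounded enstrophy) = arXiv Cor. 68, p. 36, `f = 0`: a finite energy classical
  solution of the `ν = 1` system on `[0, T] × ℝ³` with `H¹` datum lies in `X¹`;
* `tao2011_enstrophyLocalisation_exterior_unit` — Thm. 10.1 (Enstrophy localisation) = arXiv
  Thm. 59 in the exterior form of Remark 10.6 = arXiv Rem. 64, `ν = 1`;
* `tao2011_enstrophyLocalisation_exterior_apriori_unit` — the same in a priori form (energy `E` and
  total speed `M` as parameters; proof of Thm. 10.1, §10, pp. 30–33);
* `tao_unconditional_uniqueness_velocity_unit` — Cor. 11.4 (Unconditional uniqueness) = arXiv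
  Cor. 71, p. 36, velocity form justified by Remark 11.3, `ν = 1`.

Each is the `ν := 1` instance of the corresponding `ν > 0` statement of the tree, and
`TaoUnitViscosity.lean` PROVES the specialisations (`tao2011_boundedEnstrophy_iff_unit`,
`tao2011_enstrophyLocalisation_exterior_unit_of`,
`tao2011_enstrophyLocalisation_exterior_apriori_unit_of`,
`tao_unconditional_uniqueness_velocity_iff_unit`). The `ν > 0` statements are now theorems of the
tree, all resting on the discharged §10 nonlinear estimate for `Y₆`
(`tao2011_nonlinearEstimate_holds`, `TaoY6WhitneySum.lean`) together with Lemma 8.1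
(`tao_finite_energy_smooth_energy_bound_holds`) and Prop. 9.1 (`tao2011_boundedTotalSpeed_holds`):

* `tao2011_boundedEnstrophy_holds`, `tao_unconditional_uniqueness_velocity_holds`
  (`NSUnconditionalUniquenessHolds.lean`);
* `tao2011_enstrophyLocalisation_exterior_holds` (`TaoEnstrophyExteriorHolds.lean`);
* `tao2011_enstrophyLocalisation_exterior_apriori_holds` (`TaoY6WhitneySum.lean`).

Composing gives the four discharges below. A sibling file rather than an append to
`TaoUnitViscosity.lean`, because the §10 assembly (`TaoEnstrophyLocalisationAnnulus`,
`TaoAnnulusAssembly`, …) imports `TaoUnitViscosity.lean`. No statement is modified and no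
definition or named fact is introduced.

## Mathlib / tree search

`grep '^theorem …_unit_holds'` over `Literature/Analysis/FluidPDE` (2026-08-15T04:00Z): of the
five named facts of `TaoUnitViscosity.lean` only `tao2011_boundedTotalSpeed_unit_holds`
(`TaoBoundedTotalSpeedProofs.lean`) was discharged; the four names below were absent. Reused, not
restated: the conversion lemmas of `TaoUnitViscosity.lean` and the four `ν > 0` discharges listed
above.

## References

* T. Tao, *Localisation and compactness properties of the Navier–Stokes global regularity
  problem*, Anal. PDE 6 (2013) 25–107 = arXiv:1108.1165 (`Tao2011`): Cor. 11.1 (arXiv Cor. 68,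
  p. 36), Thm. 10.1 + Remark 10.6 (arXiv Thm. 59, Rem. 64, §10, pp. 30–33), Cor. 11.4 + Remark 11.3
  (arXiv Cor. 71, p. 36), Prop. 9.1 (arXiv Prop. 52), Lemma 8.1 (arXiv Lemma 44), footnote 3
  (p. 4, `ν = 1`).
-/

namespace Literature.Analysis.FluidPDE

/-- **Tao 2011, Cor. 11.1 (Bounded enstrophy) at unit viscosity, as printed — a theorem**
(discharge of the named fact `tao2011_boundedEnstrophy_unit`): the `ν := 1` instance
(`tao2011_boundedEnstrophy_iff_unit`) of the tree theorem `tao2011_boundedEnstrophy_holds`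
(Lemma 8.1 + Prop. 9.1 + Thm. 10.1/Remark 10.6 with the `Y₆` estimate + the Fourier step). [cite: Tao2011, Cor. 11.1 (arXiv Cor. 68, p. 36)] -/
theorem tao2011_boundedEnstrophy_unit_holds : tao2011_boundedEnstrophy_unit :=
  tao2011_boundedEnstrophy_iff_unit.1 tao2011_boundedEnstrophy_holds

/-- **Tao 2011, Thm. 10.1 (Enstrophy localisation), exterior form of Remark 10.6, at unit
viscosity, as printed — a theorem** (discharge of the named fact
`tao2011_enstrophyLocalisation_exterior_unit`): the `ν := 1` instance of
`tao2011_enstrophyLocalisation_exterior_holds`. [cite: Tao2011, Thm. 10.1 + Remark 10.6 (arXiv Thm. 59, Rem. 64)] -/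
theorem tao2011_enstrophyLocalisation_exterior_unit_holds :
    tao2011_enstrophyLocalisation_exterior_unit :=
  tao2011_enstrophyLocalisation_exterior_unit_of tao2011_enstrophyLocalisation_exterior_holds

/-- **Tao 2011, Thm. 10.1 (exterior form of Remark 10.6), a priori statement at unit viscosity —
a theorem** (discharge of the named fact `tao2011_enstrophyLocalisation_exterior_apriori_unit`):
the `ν := 1` instance of `tao2011_enstrophyLocalisation_exterior_apriori_holds` (the §10 argument
with the discharged `Y₆` estimate). [cite: Tao2011, Thm. 10.1 (proof, §10, pp. 30–33) + Remark 10.6] -/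
theorem tao2011_enstrophyLocalisation_exterior_apriori_unit_holds :
    tao2011_enstrophyLocalisation_exterior_apriori_unit :=
  tao2011_enstrophyLocalisation_exterior_apriori_unit_of
    tao2011_enstrophyLocalisation_exterior_apriori_holds

/-- **Tao 2011, Cor. 11.4 (Unconditional uniqueness), velocity form, at unit viscosity — a
theorem** (discharge of the named fact `tao_unconditional_uniqueness_velocity_unit`): the
`ν := 1` instance (`tao_unconditional_uniqueness_velocity_iff_unit`) of
`tao_unconditional_uniqueness_velocity_holds` (Cor. 11.1 + Cor. 4.3/Thm. 5.4 (iii), Remark 11.3). [cite: Tao2011, Cor. 11.4 + Remark 11.3 (arXiv Cor. 71, p. 36)] -/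
theorem tao_unconditional_uniqueness_velocity_unit_holds :
    tao_unconditional_uniqueness_velocity_unit :=
  tao_unconditional_uniqueness_velocity_iff_unit.1 tao_unconditional_uniqueness_velocity_holds

end Literature.Analysis.FluidPDE
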